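import Mathlib
import Summits.Schanuel.Schanuel.Theses.RigidCore
import Summits.Schanuel.Schanuel.Theorems.AclSubsetLogFreeCore.Negative.ExpAclField
import Summits.Schanuel.Schanuel.Theorems.RoyCriterionRankOne
import Literature.NumberTheory.Transcendental.LindemannWeierstrassProofs
import Summits.Schanuel.Schanuel.Theorems.RigidCoreMinimalCounterexampleInAclLinearIndependentDefinable
import Summits.Schanuel.Schanuel.Theorems.RigidCoreMinimalCounterexampleInAclLocusDefinable
import Summits.Schanuel.Schanuel.Theorems.RigidCoreMinimalCounterexampleInAclMateFirstFailure
import Summits.Schanuel.Schanuel.Theorems.RigidCoreMinimalCounterexampleInAclEndgame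
import HarnessLib.Audit

/-!
# Line `kernel-arithmetic-selection` — skeleton for crux stmt-Schanuel-0969
`Summit.Schanuel.Schanuel.Theses.RigidCore.MinimalCounterexampleInAcl` (S*)

Idea card `Cruxes/MinimalCounterexampleInAcl/Ideas/kernel-arithmetic-selection.md` (merged by triage r1 with
`isolation-is-free`: same lever); line card `Lines/kernel-arithmetic-selection.md`. Skeleton gen 3 = the LEAD'S RESHAPE
(prover-line-stmt-Schanuel-0969-0, 2026-08-16, PICKED.md) of the planner's gen 2 (stubs `stub_*`, no `Prop`-valued
defs, ONE theorem concluding the crux, branch finiteness split by rank): the gen-2 rank-≥3 branch-finiteness stub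
is split into the sweep (algebraic geometry) and the provable endgame `stub_endgame` (where `SC(<n)` is spent), and
the exp-image stub is tightened to `stub_expImageFinite_offLog` with the LOG SECTOR proved in glue
(`expImage_finite_of_algebraic`). GEN 4 (after wave 1, 2026-08-16T02:20Z): stubs 1, 2, 3 and the endgame LANDED
(p72681, p72782, p73093, p73054) and are IMPORTED; stub 4a is proved (landing as a 6-file split); the sweep is
re-split into `stub_sweepToSubspace_of_line` (Case A + collinear case + line ⟹ conclusion, proved in wave 1,
landable), `stub_sweepLine_algPeriod` (2πi algebraic over ℚ(eˣ): minimal primes + shear, provable) and the XL hard core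
`stub_sweepLine_hardCore`; registered stubs are now 5: 4a, 4b-red, 4b-alg, 4b-core, 5'.

THE LEVER. `ℂ_exp = (ℂ, +, ·, −, 0, 1, exp)` contains true arithmetic: the kernel stabiliser
`ℤ = {m | ∀ z, eᶻ = 1 → e^{mz} = 1}` is `∅`-definable (tree, PROVED: `mem_intSet_iff`, `definable_mem_intSet`,
`kmo_definable_isInt`). Hence, for a FIXED tuple `x`, the set `locusMates x` of ℚ-LINEARLY INDEPENDENT tuples `x'`
such that `(x', e^{x'})` satisfies every ℚ-polynomial relation of `(x, eˣ)` is ONE `∅`-formula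
(`stub_linearIndependentDefinable`, `stub_locusDefinable`): "definable isolation is free", and (S*) for `x` follows from
FINITENESS of `locusMates x` (project to a coordinate). The kernel cuts that finiteness into an INTEGER parameter and a
CONTINUOUS parameter,

  `locusMates x` finite ⟸ (every kernel class `x₀ + 2πiℤⁿ` meets it finitely — BRANCH FINITENESS, registered split by
                           rank: `stub_branchFiniteness_rankTwo` (provable now, HL only) / ranks ≥ 3 from
                           `stub_sweepToSubspace_higherRank` (XL AG) + `stub_endgame` (provable now) in glue)
                        ∧ (it meets finitely many kernel classes = finitely many values `e^{x'}` — log sector in glue,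
                           `stub_expImageFinite_offLog` off it),

glued by the mate-equivalence lemma `stub_mateFirstFailure` (a mate of a first failure is a first failure with the
SAME ℚ-locus: prime ideals `P_x ⊆ P_{x'}` of `ℚ[X, Y]` with quotients of equal transcendence degree `n − 1` coincide),
which transports branch finiteness from `x` to the representative `x₀` of each class; ranks `0, 1` carry no first
failure at all (`two_le_of_mem_firstFailures`, Hermite–Lindemann, sorry-free), so the first open rank is `2`.

COMPOSITION (kernel-checked, sorry-free over the seven stubs): `MinimalCounterexampleInAcl_of` is the ONLY theorem of this
file concluding the crux, BY NAME; it is `coord_mem_expAcl ∘ locusMates_finite ∘ locusMates_definable` applied to the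
stubs. Every `sorry` of the file sits inside `stub_*`. The registered stub statements are INLINED over Mathlib + tree
declarations (so a `--supports stmt-Schanuel-0969` proof in `Theorems/` can restate them textually without this file's
vocabulary); the `*_voc` lemmas below restate them over the vocabulary and are proved from the stubs by definitional
unfolding, so the agreement is kernel-checked.

RANK 2 (first open case, Disproof §11 `CruxRankTwo`): a sorry-free `example` below (Hermite–Lindemann from the tree)
shows the inductive hypothesis `∀ r < 2, SchanuelRank r` is a theorem, so `firstFailures 2 = {x | LI x ∧ trdeg < 2}` and
`stub_branchFiniteness_rankTwo` is stated without it. There the cut is a dichotomy on `Y :=` Zariski closure of the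
`y`-projection of the ℚ-locus `W` (`dim W = trdeg = 1`): `dim Y = 0` (log sector, `eˣ ∈ ℚ̄²`) ⇒ exp-image
finiteness is the glue theorem `expImage_finite_of_algebraic` and branch finiteness is the transporter lemma + HL (a component of `W_y` carrying infinitely many
translates is a line `{q·z = κ}`, `q ∈ ℤ² ∖ 0`, `κ ∈ ℚ̄`, `e^κ ∈ ℚ̄`, so `κ = 0` and every point of it is ℚ-DEPENDENT —
no mates); `dim Y = 1` ⇒ the fibres `W_y` are finite, branch finiteness is automatic, and `stub_expImageFinite_offLog`
is implied by SparsityTwo (route crux stmt-0971) for this particular locus. LANDABLE NOW: stubs 1, 2, 3, 4a, 4c — after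
which this file proves (S*) in rank 2 on the log sector OUTRIGHT and in rank 2 from `stub_expImageFinite_offLog` at
`n = 2` alone; in all ranks from 4b + 5'.

DISPROOF USED (cdisprove gen2 v11; `Disproof.lean` is item evidence only — not published under `Cruxes/…` and not mounted
in planner jails — so its eleven evidence notes were used, as by all three triagers): every stub keeps the crux's three
load-bearing hypotheses inside `firstFailures n` — `trdeg < n` (`not_withoutTrdeg`; SPENT in `stub_mateFirstFailure` to
pin both loci at `trdeg = n − 1`, and in stubs 4–5 as `dim W < n`), linear independence
(`not_withoutLinIndep_of_schanuelRank_two`; SPENT in the definition of `locusMates` — it is exactly what kills the line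
component in the rank-2 log sector), first failure `∀ r < n, SchanuelRank r` (`withoutFirstFailure_defectLeOne`; SPENT at
`r = n − 1` in `stub_mateFirstFailure` and at `r = m < n` in the sweep endgame `stub_endgame`; at
rank 2 it is a THEOREM and is discharged inside this file, not dropped); no stub is the uniform version
(`uniformVersion_iff_schanuel`: the finite set `(· i) '' locusMates x` depends on `x` through `P_x`); consistent with
`countableVersion_holds` (the open content is finiteness = stubs 4–5, not countability) and with
`crux_of_realsDefinable` / `not_realsDefinable_of_isQuasiminimal` (definability of ℝ is never used). Landed Negative
lemmas for THIS crux: none (`Theorems/MinimalCounterexampleInAcl/Negative/` does not exist); the sibling crux's landed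
library `Theorems.AclSubsetLogFreeCore.Negative.*` is imported (`expAcl` = the crux's conclusion verbatim, see the
closing `example`; its `∅`-definability kit is what stubs 1–2 are proved with). `ledger negatives --problem Schanuel`:
2 PolarPhantoms refutations, unrelated — no stub is an instance.
-/

noncomputable section

set_option linter.dupNamespace false

open Complex Set FirstOrder

namespace Summit.Schanuel.Schanuel.Cruxes.MinimalCounterexampleInAcl.KernelArithmeticSelection

open Literature.NumberTheory.Transcendental (SchanuelRank)
open Literature.ModelTheory.ExponentialFields
open Summit.Schanuel.Schanuel.Theorems.AclSubsetLogFreeCore.Negative (expAcl)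

/-! ## Vocabulary (Set-valued definitions over Mathlib + tree declarations; no `Prop`-valued defs) -/

variable {n : ℕ}

/-- The ℚ-locus of `(x, eˣ)` pulled back along `z ↦ (z, eᶻ)`: tuples `x'` such that `(x', e^{x'})` satisfies every
ℚ-polynomial relation of `(x, eˣ)` (i.e. `P_x ⊆ P_{x'}` for the prime ideals of relations in `ℚ[X₁…Xₙ, Y₁…Yₙ]`). -/
def locusPts (x : Fin n → ℂ) : Set (Fin n → ℂ) :=
  {x' | ∀ p : MvPolynomial (Fin n ⊕ Fin n) ℚ,
    MvPolynomial.aeval (Sum.elim x (cexp ∘ x)) p = 0 →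
    MvPolynomial.aeval (Sum.elim x' (cexp ∘ x')) p = 0}

/-- The MATES of `x`: ℚ-linearly independent points of the pulled-back ℚ-locus of `(x, eˣ)`. -/
def locusMates (x : Fin n → ℂ) : Set (Fin n → ℂ) :=
  {x' : Fin n → ℂ | LinearIndependent ℚ x'} ∩ locusPts x

/-- The first-failure counterexamples at rank `n` — verbatim the crux's hypothesis bundle (`x` ℚ-linearly independent,
`trdeg ℚ(x, eˣ) < n`, Schanuel in every rank `r < n`), as a SET of tuples (empty under Schanuel's conjecture). -/
def firstFailures (n : ℕ) : Set (Fin n → ℂ) :=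
  {x | LinearIndependent ℚ x ∧
    Algebra.trdeg ℚ ↥(IntermediateField.adjoin ℚ (range x ∪ range (cexp ∘ x))) < (n : Cardinal) ∧
    ∀ r < n, SchanuelRank r}

/-- The kernel translate `x + 2πi·k` of a tuple by an integer vector. -/
def kerTranslate (x : Fin n → ℂ) (k : Fin n → ℤ) : Fin n → ℂ :=
  fun i => x i + 2 * ↑Real.pi * I * (k i : ℂ)

/-- Membership in the vocabulary sets is by definitional unfolding (`Iff.rfl`); recorded as `example`s so that the
file carries no declaration off the path to the crux. -/
example {x x' : Fin n → ℂ} : x' ∈ locusPts x ↔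
    ∀ p : MvPolynomial (Fin n ⊕ Fin n) ℚ, MvPolynomial.aeval (Sum.elim x (cexp ∘ x)) p = 0 →
      MvPolynomial.aeval (Sum.elim x' (cexp ∘ x')) p = 0 := Iff.rfl

example {x x' : Fin n → ℂ} : x' ∈ locusMates x ↔ LinearIndependent ℚ x' ∧ x' ∈ locusPts x := Iff.rfl

example {x : Fin n → ℂ} : x ∈ firstFailures n ↔
    LinearIndependent ℚ x ∧
    Algebra.trdeg ℚ ↥(IntermediateField.adjoin ℚ (range x ∪ range (cexp ∘ x))) < (n : Cardinal) ∧
    ∀ r < n, SchanuelRank r := Iff.rfl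

/-! ## The registered stubs — `sorry` lives ONLY here (gen 4: five, of which 4a and 4b-red are proved and landing).
Statements are INLINED over Mathlib + tree declarations (fully qualified, no `:=` inside), so that a stub worker's
`Theorems/RigidCoreMinimalCounterexampleInAcl<Stub>.lean` can state `theorem <stub> : <signature>` verbatim in this
namespace with imports `Mathlib`, `Summits.Schanuel.Schanuel.Theses.RigidCore` (+ the definability kit
`Summits.Schanuel.Schanuel.Theorems.AclSubsetLogFreeCore.Negative.ExpAclField` for stubs 1–2,
`Literature.NumberTheory.Transcendental.LindemannWeierstrassProofs` for Hermite–Lindemann in stubs 3–4a). -/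

/-! LANDED (wave 1, 2026-08-16): `stub_linearIndependentDefinable` (p72681,
`Theorems/RigidCoreMinimalCounterexampleInAclLinearIndependentDefinable.lean`), `stub_locusDefinable` (p72782,
`…LocusDefinable.lean`), `stub_mateFirstFailure` (p73093, `…MateFirstFailure.lean`), `stub_endgame` (p73054,
`…Endgame.lean`) — imported above under their registered names; `stub_branchFiniteness_rankTwo` is PROVED
(work/stubs/stub_branchFiniteness_rankTwo.lean, 1776 lines, sorry-free) and is being landed as a 6-file split
(5 Literature helpers + the stub file). -/

/-- **Stub 4a — BRANCH FINITENESS AT RANK 2, the integer parameter in the first open case (support, PROVABLE NOW, size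
L ≈ 600 lines; = K1/K3 of card sweep-below-rank at `n = 2`, Baker-free).** Only finitely many kernel translates
`x + 2πik`, `k ∈ ℤ²`, of a ℚ-linearly independent pair `x` with `trdeg ℚ(x, eˣ) < 2` are mates of `x`. The inductive
hypothesis `∀ r < 2, SchanuelRank r` is OMITTED because it is a theorem (ranks 0, 1: `schanuelRank_zero`,
Hermite–Lindemann; see the rank-bookkeeping `example`s below and Disproof §11 `CruxRankTwo`) — so this is NOT the
`withoutFirstFailure` weakening the Disproof warns about; it is still implied by `SC(2)` (vacuous), irrefutable short of
`¬SC(2)`. Proof (triage r1-1/2/3, `StructureLemmaTwo` in TriageR1K3.lean): put `y = eˣ`, `W = V(P_x) ⊂ ℂ² × ℂ²`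
(`dim W = trdeg = 1` by `SchanuelRank 1`); translates have the same `y`, so they lie in the fibre `W_y ⊂ ℂ²`, an
algebraic set over `ℚ(y)` of dimension `≤ 1`. (i) `y ∉ ℚ̄²`: then `trdeg ℚ(y) = 1 = trdeg ℚ(x, y)`, each `xᵢ` is
algebraic over `ℚ(y)`, i.e. `fᵢ(Xᵢ, Y) ∈ P_x` with `fᵢ(T, y) ≢ 0`, so `W_y ⊆ {z | fᵢ(zᵢ, y) = 0}` is FINITE. (ii) `y ∈ ℚ̄²`
(log sector): if infinitely many translates `x + 2πik`, `k ∈ D`, are mates, the Zariski closure `A` of `D ⊂ ℤ²` has a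
curve component `A₀ ∋` infinitely many of them and `C := x + 2πi·A₀` is an irreducible component of `W_y`, defined over
`ℚ̄`. The `ℚ̄`-closed condition `{(a, τ) | a + τ·A₀ ⊆ C}` holds at `(x, 2πi)`, hence on the whole `ℚ̄`-locus `V` of
`(x, 2πi)`, on which `τ` is non-constant (`2πi ∉ ℚ̄`): so `C = a + τA₀` for infinitely many ratios `τ/2πi`, i.e. the
affine stabiliser of `C` inside `{z ↦ λz + μ}` is infinite, hence positive-dimensional, and an irreducible plane curve
with such a stabiliser is a LINE (orbits of 1-parameter subgroups of `𝔾_m ⋉ 𝔾_a²` are lines; or compare homogeneous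
parts of `F(λz + μ_λ) = λ^d F(z)`). Its direction `2πi(k − k')` is rational: `C = {z | q·z = κ}`, `q ∈ ℤ² ∖ 0`,
`κ ∈ ℚ̄` (value at a `ℚ̄`-point of `C`), and `κ = q·x + 2πi(q·k)` gives `e^κ = y₁^{q₁} y₂^{q₂} ∈ ℚ̄`, so `κ = 0` by
Hermite–Lindemann (`transcendental_exp_holds`) — but then EVERY point of `C` is ℚ-linearly dependent and `C` carries no
mate at all: contradiction. (This is where linear independence OF THE MATES is spent; no Baker. Cf. supports
0974/0975 and torsor-self-selection's `LogPairCounterexampleInAcl`, e.g. "π, log 2 algebraically dependent ⇒ only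
finitely many pairs (log 2 + 2πik₁, iπ(1 + 2k₂)) on the relation curve".) -/
theorem stub_branchFiniteness_rankTwo : ∀ (x : Fin 2 → ℂ), (LinearIndependent ℚ x ∧ Algebra.trdeg ℚ ↥(IntermediateField.adjoin ℚ (Set.range x ∪ Set.range (Complex.exp ∘ x))) < (2 : Cardinal)) → {k : Fin 2 → ℤ | LinearIndependent ℚ (fun i => x i + 2 * ↑Real.pi * Complex.I * (k i : ℂ)) ∧ ∀ p : MvPolynomial (Fin 2 ⊕ Fin 2) ℚ, MvPolynomial.aeval (Sum.elim x (Complex.exp ∘ x)) p = 0 → MvPolynomial.aeval (Sum.elim (fun i => x i + 2 * ↑Real.pi * Complex.I * (k i : ℂ)) (Complex.exp ∘ fun i => x i + 2 * ↑Real.pi * Complex.I * (k i : ℂ))) p = 0}.Finite := by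
  sorry

/-- **Stub 4b-red — SWEEP: REDUCTION TO A LINE IN THE HARD CASE (ranks ≥ 3; PROVED in wave 1 up to packaging,
LANDABLE NOW from work/stubs/stub_sweepToSubspace_higherRank.lean; lead's second reshape of the rank-≥3 sweep).**
For a first failure `x` of rank `n ≥ 3` with infinitely many mate-translates `x + 2πik` (the set `D`), the registered
conclusion of the sweep (a rational-direction affine subspace of codimension `m < n` through a mate-translate inside the
fibre `W_y`, `y = eˣ`) holds PROVIDED the hard case delivers a line: hypothesis = "if `2πi` is algebraic over
`ℚ(x, eˣ)` and no rational line `k₀ + ℤv` through a mate `k₀ ∈ D` carries infinitely many translates in the fibre, then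
some complex line `x + 2πik₀ + ℂv` (`k₀ ∈ D`, `v ∈ ℤⁿ ∖ 0`) lies in `W_y`". Proof (wave-1 worker, sorry-free):
CASE A — `2πi` transcendental over `K = ℚ(x, eˣ)`: for `p ∈ P_x` and `k ∈ D ∖ 0`, `s ↦ p(x + sk, eˣ)` is a polynomial
over `K` vanishing at `s = 2πi`, hence identically, so the line `x + ℂk` lies in `W_y` (`inW_line_of_transcendental`);
COLLINEAR CASE — infinitely many `k ∈ D` on one rational line `k₀ + ℤv`: the complex line `x + 2πik₀ + ℂv` meets `W_y`
infinitely often, hence lies in it (`aeval_line_eq_zero_of_infinite`); LINE ⟹ CONCLUSION with `m = n − 1` and the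
explicit independent forms `q_j = v_{i₀} e_j − v_j e_{i₀}` (`concl_of_line`). No hypothesis of the bundle is consumed
here (drefute g2: the sweep is "SweepFree"). -/
theorem stub_sweepToSubspace_of_line : ∀ (n : ℕ), 3 ≤ n → ∀ (x : Fin n → ℂ), (LinearIndependent ℚ x ∧ Algebra.trdeg ℚ ↥(IntermediateField.adjoin ℚ (Set.range x ∪ Set.range (Complex.exp ∘ x))) < (n : Cardinal) ∧ ∀ r < n, Literature.NumberTheory.Transcendental.SchanuelRank r) → {k : Fin n → ℤ | LinearIndependent ℚ (fun i => x i + 2 * ↑Real.pi * Complex.I * (k i : ℂ)) ∧ ∀ p : MvPolynomial (Fin n ⊕ Fin n) ℚ, MvPolynomial.aeval (Sum.elim x (Complex.exp ∘ x)) p = 0 → MvPolynomial.aeval (Sum.elim (fun i => x i + 2 * ↑Real.pi * Complex.I * (k i : ℂ)) (Complex.exp ∘ fun i => x i + 2 * ↑Real.pi * Complex.I * (k i : ℂ))) p = 0}.Infinite → (IsAlgebraic ↥(IntermediateField.adjoin ℚ (Set.range x ∪ Set.range (Complex.exp ∘ x))) (2 * ↑Real.pi * Complex.I) → (∀ (k₀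 v : Fin n → ℤ), v ≠ 0 → (LinearIndependent ℚ (fun i => x i + 2 * ↑Real.pi * Complex.I * (k₀ i : ℂ)) ∧ ∀ p : MvPolynomial (Fin n ⊕ Fin n) ℚ, MvPolynomial.aeval (Sum.elim x (Complex.exp ∘ x)) p = 0 → MvPolynomial.aeval (Sum.elim (fun i => x i + 2 * ↑Real.pi * Complex.I * (k₀ i : ℂ)) (Complex.exp ∘ fun i => x i + 2 * ↑Real.pi * Complex.I * (k₀ i : ℂ))) p = 0) → {t : ℤ | ∀ p : MvPolynomial (Fin n ⊕ Fin n) ℚ, MvPolynomial.aeval (Sum.elim x (Complex.exp ∘ x)) p = 0 → MvPolynomial.aeval (Sum.elim (fun i => x i + 2 * ↑Real.pi * Complex.I * ((k₀ + t • v) i : ℂ)) (Complex.exp ∘ fun i => x i + 2 * ↑Real.pi * Complex.I * ((k₀ + t • v) i : ℂ))) p = 0}.Finite) → (∃ (k₀ v : Fin n → ℤ), v ≠ 0 ∧ (LinearIndependent ℚ (fun i => x i + 2 * ↑Real.pi * Complex.I * (k₀ i : ℂ)) ∧ ∀ p : MvPolynomial (Fin n ⊕ Fin n) ℚ, MvPolynomial.aeval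 (Sum.elim x (Complex.exp ∘ x)) p = 0 → MvPolynomial.aeval (Sum.elim (fun i => x i + 2 * ↑Real.pi * Complex.I * (k₀ i : ℂ)) (Complex.exp ∘ fun i => x i + 2 * ↑Real.pi * Complex.I * (k₀ i : ℂ))) p = 0) ∧ ∀ s : ℂ, ∀ p : MvPolynomial (Fin n ⊕ Fin n) ℚ, MvPolynomial.aeval (Sum.elim x (Complex.exp ∘ x)) p = 0 → MvPolynomial.aeval (Sum.elim (fun i => x i + 2 * ↑Real.pi * Complex.I * (k₀ i : ℂ) + s * (v i : ℂ)) (Complex.exp ∘ x)) p = 0)) → ∃ (m : ℕ) (q : Fin m → Fin n → ℚ) (k₀ : Fin n → ℤ), m < n ∧ LinearIndependent ℚ q ∧ (LinearIndependent ℚ (fun i => x i + 2 * ↑Real.pi * Complex.I * (k₀ i : ℂ)) ∧ ∀ p : MvPolynomial (Fin n ⊕ Fin n) ℚ, MvPolynomial.aeval (Sum.elim x (Complex.exp ∘ x)) p = 0 → MvPolynomial.aeval (Sum.elim (fun i => x i + 2 * ↑Real.pi * Complex.I * (k₀ i : ℂ)) (Complex.exp ∘ fun i => x i + 2 * ↑Real.pi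 * Complex.I * (k₀ i : ℂ))) p = 0) ∧ ∀ z : Fin n → ℂ, (∀ j, ∑ i, (q j i : ℂ) * z i = ∑ i, (q j i : ℂ) * (x i + 2 * ↑Real.pi * Complex.I * (k₀ i : ℂ))) → ∀ p : MvPolynomial (Fin n ⊕ Fin n) ℚ, MvPolynomial.aeval (Sum.elim x (Complex.exp ∘ x)) p = 0 → MvPolynomial.aeval (Sum.elim z (Complex.exp ∘ x)) p = 0 := by
  sorry

/-- **Stub 4b-alg — THE LINE WHEN `2πi` IS ALGEBRAIC OVER `ℚ(eˣ)` (ranks ≥ 3; provable now, size M–L ≈ 250 lines;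
wave-1 worker's note 4).** If `2πi` is algebraic over `ℚ(y)`, `y = eˣ`, with minimal relation `M(y, 2πi) = 0`,
`M ∈ ℚ[Y, T]`, then the prime ideals `Q_k := I((x + 2πik, y, 2πi)/ℚ) ⊂ ℚ[X, Y, T]`, `k ∈ D`, all contain
`J := P_x·ℚ[X,Y,T] + (M)` (mate-translates are generic points of `P_x`: `isGenericPt_kerTranslate`, via
`LocusComponents.isGenericPt_of_trdeg_le` + `SchanuelRank (n−1)`) and have the dimension `n − 1` of `J`, hence are
MINIMAL primes of `J` (`Literature.RingTheory.KrullDimension.trdeg_quotient_lt`) — finitely many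
(`Ideal.finite_minimalPrimes_of_isNoetherianRing`) — so `Q_{k₁} = Q_{k₂} =: Q` for some `k₁ ≠ k₂` in the infinite `D`;
the shear `X ↦ X + T(k₂ − k₁)` (a ℚ-algebra automorphism of `ℚ[X,Y,T]`) maps `Q_{k₂}` onto `Q_{k₁}`, so it stabilises
`Q`, and iterating gives `x + 2πik₁ + j·2πi(k₂ − k₁) ∈ W_y` for all `j ∈ ℤ`; a line meeting `W_y` infinitely often
lies in it: the line `x + 2πik₁ + ℂ(k₂ − k₁)` (`k₁ ∈ D`, `k₂ − k₁ ∈ ℤⁿ ∖ 0`). (Alternative: primes of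
`(ℚ[X,Y]⧸P_x)[T]` over `0` containing `M̄` ↔ irreducible factors of `M` over the function field `ℚ(W)`.) -/
theorem stub_sweepLine_algPeriod : ∀ (n : ℕ), 3 ≤ n → ∀ (x : Fin n → ℂ), (LinearIndependent ℚ x ∧ Algebra.trdeg ℚ ↥(IntermediateField.adjoin ℚ (Set.range x ∪ Set.range (Complex.exp ∘ x))) < (n : Cardinal) ∧ ∀ r < n, Literature.NumberTheory.Transcendental.SchanuelRank r) → {k : Fin n → ℤ | LinearIndependent ℚ (fun i => x i + 2 * ↑Real.pi * Complex.I * (k i : ℂ)) ∧ ∀ p : MvPolynomial (Fin n ⊕ Fin n) ℚ, MvPolynomial.aeval (Sum.elim x (Complex.exp ∘ x)) p = 0 → MvPolynomial.aeval (Sum.elim (fun i => x i + 2 * ↑Real.pi * Complex.I * (k i : ℂ)) (Complex.exp ∘ fun i => x i + 2 * ↑Real.pi * Complex.I * (k i : ℂ))) p = 0}.Infinite → IsAlgebraic ↥(IntermediateField.adjoin ℚ (Set.range (Complex.exp ∘ x))) (2 * ↑Real.pi * Complex.I) → (∃ (k₀ v : Fin n → ℤ), v ≠ 0 ∧ (LinearIndependent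 ℚ (fun i => x i + 2 * ↑Real.pi * Complex.I * (k₀ i : ℂ)) ∧ ∀ p : MvPolynomial (Fin n ⊕ Fin n) ℚ, MvPolynomial.aeval (Sum.elim x (Complex.exp ∘ x)) p = 0 → MvPolynomial.aeval (Sum.elim (fun i => x i + 2 * ↑Real.pi * Complex.I * (k₀ i : ℂ)) (Complex.exp ∘ fun i => x i + 2 * ↑Real.pi * Complex.I * (k₀ i : ℂ))) p = 0) ∧ ∀ s : ℂ, ∀ p : MvPolynomial (Fin n ⊕ Fin n) ℚ, MvPolynomial.aeval (Sum.elim x (Complex.exp ∘ x)) p = 0 → MvPolynomial.aeval (Sum.elim (fun i => x i + 2 * ↑Real.pi * Complex.I * (k₀ i : ℂ) + s * (v i : ℂ)) (Complex.exp ∘ x)) p = 0) := by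
  sorry

/-- **Stub 4b-core — THE HARD CORE OF THE SWEEP (ranks ≥ 3; theorem-candidate, size XL = the structure lemma of
card sweep-below-rank in its line form).** `x` a first failure of rank `n ≥ 3`, `D` (mate-translates) infinite, `2πi`
ALGEBRAIC over `ℚ(x, eˣ)` but TRANSCENDENTAL over `ℚ(eˣ)`, and `D` NOT concentrated on any rational line through a
mate (`{t | x + 2πi(k₀ + tv) ∈ W_y}` finite for all `k₀ ∈ D`, `v ≠ 0`) ⟹ some complex line `x + 2πik₀ + ℂv`
(`k₀ ∈ D`, `v ∈ ℤⁿ ∖ 0`) lies in `W_y`. Irrefutable short of `¬SC`. Plan (drefute g2, recursion-free structure lemma;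
triage r1-1/2/3): transporter on the `K`-locus `V` of `(x, 2πi)`, `K = ℚ(y)^alg`, copies `a + τA₀ ⊆ W_y` (`A₀` a
positive-dimensional ℚ-component of the Zariski closure of `D`); fibre count ⇒ `≥ dim A₀` copies through a generic
`z₀` of the component `X'`; either base points dense in `A₀` (tangent spaces span `Π₀ = span_ℚ(D₀ − D₀)`) or a
1-dimensional `τ`-family gives the cone `z₀ + ℂ(A₀ − p) ⊆ X'`; so `T_{z₀}X' ⊇ Π₀ ⊗ ℂ` generically ⇒ `X' + Π₀ = X'`
(translation lemma) ⇒ the LINE. Classical AG inputs to vendor (each L+; drefute g2 / wave-1 inventory): fibre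
dimension (tree HAS `FibreInequality.ringKrullDim_le_ringKrullDim_quotient_add`, `FibreDimension.…generic fibre`),
tangent cone ⊆ tangent space (tree `TangentDimension.tangentSpaceAt`), char-0 Gauss/affine-hull lemma (MISSING),
translation lemma (MISSING), dim locus = trdeg (tree `ExpVarietiesDimension.zariskiDim_zeroLocus_eq_trdeg`) + generic
fibre at a ℚ-generic point, Zariski closure of infinite lattice subsets has a positive-dimensional ℚ-component meeting
them infinitely (MISSING, M). The parabola `k₂ = k₁²` shows infinitude of lattice points alone is not enough (cdisprove
g3): the proof must use the frozen-exponential fibre structure (`2πi ∈ ℚ(x, eˣ)^alg`). -/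
theorem stub_sweepLine_hardCore : ∀ (n : ℕ), 3 ≤ n → ∀ (x : Fin n → ℂ), (LinearIndependent ℚ x ∧ Algebra.trdeg ℚ ↥(IntermediateField.adjoin ℚ (Set.range x ∪ Set.range (Complex.exp ∘ x))) < (n : Cardinal) ∧ ∀ r < n, Literature.NumberTheory.Transcendental.SchanuelRank r) → {k : Fin n → ℤ | LinearIndependent ℚ (fun i => x i + 2 * ↑Real.pi * Complex.I * (k i : ℂ)) ∧ ∀ p : MvPolynomial (Fin n ⊕ Fin n) ℚ, MvPolynomial.aeval (Sum.elim x (Complex.exp ∘ x)) p = 0 → MvPolynomial.aeval (Sum.elim (fun i => x i + 2 * ↑Real.pi * Complex.I * (k i : ℂ)) (Complex.exp ∘ fun i => x i + 2 * ↑Real.pi * Complex.I * (k i : ℂ))) p = 0}.Infinite → IsAlgebraic ↥(IntermediateField.adjoin ℚ (Set.range x ∪ Set.range (Complex.exp ∘ x))) (2 * ↑Real.pi * Complex.I) → ¬ IsAlgebraic ↥(IntermediateField.adjoin ℚ (Set.range (Complex.exp ∘ x))) (2 * ↑Real.pi * Complex.I) → (∀ (k₀ v : Fin n → ℤ), v ≠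 0 → (LinearIndependent ℚ (fun i => x i + 2 * ↑Real.pi * Complex.I * (k₀ i : ℂ)) ∧ ∀ p : MvPolynomial (Fin n ⊕ Fin n) ℚ, MvPolynomial.aeval (Sum.elim x (Complex.exp ∘ x)) p = 0 → MvPolynomial.aeval (Sum.elim (fun i => x i + 2 * ↑Real.pi * Complex.I * (k₀ i : ℂ)) (Complex.exp ∘ fun i => x i + 2 * ↑Real.pi * Complex.I * (k₀ i : ℂ))) p = 0) → {t : ℤ | ∀ p : MvPolynomial (Fin n ⊕ Fin n) ℚ, MvPolynomial.aeval (Sum.elim x (Complex.exp ∘ x)) p = 0 → MvPolynomial.aeval (Sum.elim (fun i => x i + 2 * ↑Real.pi * Complex.I * ((k₀ + t • v) i : ℂ)) (Complex.exp ∘ fun i => x i + 2 * ↑Real.pi * Complex.I * ((k₀ + t • v) i : ℂ))) p = 0}.Finite) → (∃ (k₀ v : Fin n → ℤ), v ≠ 0 ∧ (LinearIndependent ℚ (fun i => x i + 2 * ↑Real.pi * Complex.I * (k₀ i : ℂ)) ∧ ∀ p : MvPolynomial (Fin n ⊕ Fin n) ℚ, MvPolynomial.aeval (Sum.elim x (Complex.exp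 ∘ x)) p = 0 → MvPolynomial.aeval (Sum.elim (fun i => x i + 2 * ↑Real.pi * Complex.I * (k₀ i : ℂ)) (Complex.exp ∘ fun i => x i + 2 * ↑Real.pi * Complex.I * (k₀ i : ℂ))) p = 0) ∧ ∀ s : ℂ, ∀ p : MvPolynomial (Fin n ⊕ Fin n) ℚ, MvPolynomial.aeval (Sum.elim x (Complex.exp ∘ x)) p = 0 → MvPolynomial.aeval (Sum.elim (fun i => x i + 2 * ↑Real.pi * Complex.I * (k₀ i : ℂ) + s * (v i : ℂ)) (Complex.exp ∘ x)) p = 0) := by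
  sorry

/-- **Stub 5' — EXP-IMAGE FINITENESS OFF THE LOG SECTOR, the continuous parameter (HARDEST; the open residue of (S*) on
this line, size XL / research; lead's tightening of the gen-2 stub `stub_expImageFinite` — the LOG SECTOR, all `e^{x_i}`
algebraic, is now the sorry-free glue theorem `expImage_finite_of_algebraic`).** For a first failure `x` with SOME
`e^{x_i}` transcendental, the mates of `x` have only finitely many exponential images `e^{x'} ∈ Y := pr_y(W)`
(equivalently: the mate set meets finitely many kernel classes). Irrefutable short of `¬SC`. At `n = 2` (`dim W = 1`,
`dim Y = 1`) it is implied by SparsityTwo (stmt-Schanuel-0971) for the locus `W` (`W` is `IsDefinedOver ⊥`,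
`zariskiDim W = 1 < 2`) — known on non-Γ-symmetric curves (modulus splitting, ModulusFirst.FinitenessTwoFeedsSparsityTwo),
finite-`y`-projection curves (Theorem L), one real-quadratic slope with torsion phases (Thm P), two independent algebraic
slopes (Schmidt); OPEN exactly on the Shapiro/Dirichlet atoms (single real algebraic slope of degree ≥ 3, non-torsion
phases: DMT arXiv:1206.6747 §5, Fischler–Rivoal arXiv:2503.20345 Thm 1.7 only under SC). Attack (cards ends-not-points
L2–L4, modulus-first): mates are ISOLATED points of `{z | (z, eᶻ) ∈ W}` (Ax–Schanuel `ax_schanuel_holds` + `SC(n−m)`),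
isolated points of a closed analytic set are closed-discrete, so the stub says that ℚ-independent graph points of `W` do
not ESCAPE TO INFINITY along infinitely many classes; bounded-coordinate ends are discharged by HL (L4), all-divergent
ends by o-minimal / modulus counting (BNZ arXiv:2202.05305 polylog sparsity off `{q·x = 0}`). -/
theorem stub_expImageFinite_offLog : ∀ (n : ℕ) (x : Fin n → ℂ), (LinearIndependent ℚ x ∧ Algebra.trdeg ℚ ↥(IntermediateField.adjoin ℚ (Set.range x ∪ Set.range (Complex.exp ∘ x))) < (n : Cardinal) ∧ ∀ r < n, Literature.NumberTheory.Transcendental.SchanuelRank r) → (∃ i, Transcendental ℚ (Complex.exp (x i))) → ((fun x' : Fin n → ℂ => Complex.exp ∘ x') '' {x' : Fin n → ℂ | LinearIndependent ℚ x' ∧ ∀ p : MvPolynomial (Fin n ⊕ Fin n) ℚ, MvPolynomial.aeval (Sum.elim x (Complex.exp ∘ x)) p = 0 → MvPolynomial.aeval (Sum.elim x' (Complex.exp ∘ x')) p = 0}).Finite := by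
  sorry

/-! ## The stubs over the vocabulary (definitional agreement, kernel-checked; these carry `sorry` only through the
stubs they invoke) -/

theorem linearIndependent_definable_voc (n : ℕ) :
    (∅ : Set ℂ).Definable Language.expRing {v : Fin n → ℂ | LinearIndependent ℚ v} :=
  stub_linearIndependentDefinable n

theorem locusPts_definable_voc (x : Fin n → ℂ) : (∅ : Set ℂ).Definable Language.expRing (locusPts x) :=
  stub_locusDefinable n x

theorem mate_firstFailure_voc {x x' : Fin n → ℂ} (hx : x ∈ firstFailures n) (hx' : x' ∈ locusMates x) :
    x' ∈ firstFailures n ∧ locusPts x' = locusPts x :=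
  stub_mateFirstFailure n x x' hx hx'

/-- Schanuel in rank `1` is a theorem of the tree (Hermite–Lindemann `transcendental_exp_holds`). -/
theorem schanuelRank_one : SchanuelRank 1 :=
  Literature.Transcend.schanuelRank_one_of_transcendental_exp
    Literature.NumberTheory.Transcendental.transcendental_exp_holds

/-- There are no first failures in ranks `0` and `1` (rank 1 by Hermite–Lindemann), so every statement about them is
vacuous there; the first open rank is `2`. -/
theorem two_le_of_mem_firstFailures {x : Fin n → ℂ} (hx : x ∈ firstFailures n) : 2 ≤ n := by
  rcases hx with ⟨hli, htr, -⟩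
  by_contra hn
  interval_cases n
  · simp at htr
  · exact absurd htr (not_lt.2 (schanuelRank_one x hli))

/-- Kernel translates have the same exponentials. -/
theorem cexp_comp_kerTranslate (x : Fin n → ℂ) (k : Fin n → ℤ) : cexp ∘ kerTranslate x k = cexp ∘ x := by
  funext i
  simp only [Function.comp_apply, kerTranslate]
  rw [Complex.exp_add, mul_comm (2 * ↑Real.pi * I) ((k i : ℂ)), Complex.exp_int_mul_two_pi_mul_I, mul_one]

theorem sweepLine_voc {x : Fin n → ℂ} (h3 : 3 ≤ n) (hx : x ∈ firstFailures n)
    (hinf : {k : Fin n → ℤ | kerTranslate x k ∈ locusMates x}.Infinite)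
    (hB : IsAlgebraic ↥(IntermediateField.adjoin ℚ (Set.range x ∪ Set.range (Complex.exp ∘ x))) (2 * ↑Real.pi * Complex.I)) (hnc : (∀ (k₀ v : Fin n → ℤ), v ≠ 0 → (LinearIndependent ℚ (fun i => x i + 2 * ↑Real.pi * Complex.I * (k₀ i : ℂ)) ∧ ∀ p : MvPolynomial (Fin n ⊕ Fin n) ℚ, MvPolynomial.aeval (Sum.elim x (Complex.exp ∘ x)) p = 0 → MvPolynomial.aeval (Sum.elim (fun i => x i + 2 * ↑Real.pi * Complex.I * (k₀ i : ℂ)) (Complex.exp ∘ fun i => x i + 2 * ↑Real.pi * Complex.I * (k₀ i : ℂ))) p = 0) → {t : ℤ | ∀ p : MvPolynomial (Fin n ⊕ Fin n) ℚ, MvPolynomial.aeval (Sum.elim x (Complex.exp ∘ x)) p = 0 → MvPolynomial.aeval (Sum.elim (fun i => x i + 2 * ↑Real.pi * Complex.I * ((k₀ + t • v) i : ℂ)) (Complex.exp ∘ fun i => x i + 2 * ↑Real.pi * Complex.I * ((k₀ + t • v) i : ℂ))) p = 0}.Finite)) :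
    (∃ (k₀ v : Fin n → ℤ), v ≠ 0 ∧ (LinearIndependent ℚ (fun i => x i + 2 * ↑Real.pi * Complex.I * (k₀ i : ℂ)) ∧ ∀ p : MvPolynomial (Fin n ⊕ Fin n) ℚ, MvPolynomial.aeval (Sum.elim x (Complex.exp ∘ x)) p = 0 → MvPolynomial.aeval (Sum.elim (fun i => x i + 2 * ↑Real.pi * Complex.I * (k₀ i : ℂ)) (Complex.exp ∘ fun i => x i + 2 * ↑Real.pi * Complex.I * (k₀ i : ℂ))) p = 0) ∧ ∀ s : ℂ, ∀ p : MvPolynomial (Fin n ⊕ Fin n) ℚ, MvPolynomial.aeval (Sum.elim x (Complex.exp ∘ x)) p = 0 → MvPolynomial.aeval (Sum.elim (fun i => x i + 2 * ↑Real.pi * Complex.I * (k₀ i : ℂ) + s * (v i : ℂ)) (Complex.exp ∘ x)) p = 0) := by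
  by_cases hY : IsAlgebraic ↥(IntermediateField.adjoin ℚ (Set.range (Complex.exp ∘ x))) (2 * ↑Real.pi * Complex.I)
  · exact stub_sweepLine_algPeriod n h3 x hx hinf hY
  · exact stub_sweepLine_hardCore n h3 x hx hinf hB hY hnc

theorem sweepToSubspace_voc {x : Fin n → ℂ} (h3 : 3 ≤ n) (hx : x ∈ firstFailures n)
    (hinf : {k : Fin n → ℤ | kerTranslate x k ∈ locusMates x}.Infinite) :
    ∃ (m : ℕ) (q : Fin m → Fin n → ℚ) (k₀ : Fin n → ℤ), m < n ∧ LinearIndependent ℚ q ∧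
      kerTranslate x k₀ ∈ locusMates x ∧
      ∀ z : Fin n → ℂ, (∀ j, ∑ i, (q j i : ℂ) * z i = ∑ i, (q j i : ℂ) * kerTranslate x k₀ i) →
        ∀ p : MvPolynomial (Fin n ⊕ Fin n) ℚ, MvPolynomial.aeval (Sum.elim x (cexp ∘ x)) p = 0 →
          MvPolynomial.aeval (Sum.elim z (cexp ∘ x)) p = 0 :=
  stub_sweepToSubspace_of_line n h3 x hx hinf (sweepLine_voc h3 hx hinf)

theorem endgame_voc {x : Fin n → ℂ} (hx : x ∈ firstFailures n) {m : ℕ} (hm : m < n)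
    {q : Fin m → Fin n → ℚ} (hq : LinearIndependent ℚ q)
    (hN : ∀ z : Fin n → ℂ, (∀ j, ∑ i, (q j i : ℂ) * z i = ∑ i, (q j i : ℂ) * x i) →
      ∀ p : MvPolynomial (Fin n ⊕ Fin n) ℚ, MvPolynomial.aeval (Sum.elim x (cexp ∘ x)) p = 0 →
        MvPolynomial.aeval (Sum.elim z (cexp ∘ x)) p = 0) : False :=
  stub_endgame n x hx m hm q hq hN

/-- Branch finiteness in ranks `≥ 3` from the sweep (stub 4b), the mate equivalence (stub 3) and the endgame (stub 4c):
an infinite kernel class of mates of `x` yields a rational affine subspace through a surviving mate-translate `x*` inside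
the fibre; `x*` is a first failure with the SAME locus and the SAME exponentials as `x`, so the endgame applies to it. -/
theorem branch_finite_higherRank {x : Fin n → ℂ} (h3 : 3 ≤ n) (hx : x ∈ firstFailures n) :
    {k : Fin n → ℤ | kerTranslate x k ∈ locusMates x}.Finite := by
  by_contra hinf
  obtain ⟨m, q, k₀, hm, hq, hk₀, hN⟩ := sweepToSubspace_voc h3 hx hinf
  obtain ⟨hff, hlocus⟩ := mate_firstFailure_voc hx hk₀
  have hxmem : x ∈ locusPts (kerTranslate x k₀) := by
    rw [hlocus]
    exact fun _ hp => hp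
  refine endgame_voc hff hm hq ?_
  intro z hz p hp
  rw [cexp_comp_kerTranslate]
  exact hN z hz p (hxmem p hp)

/-- Branch finiteness in every rank (ranks `0, 1` vacuous; rank `2` = stub 4a with its inductive hypothesis discharged;
ranks `≥ 3` = `branch_finite_higherRank` from stubs 4b + 3 + 4c). -/
theorem branch_finite_voc {x : Fin n → ℂ} (hx : x ∈ firstFailures n) :
    {k : Fin n → ℤ | kerTranslate x k ∈ locusMates x}.Finite := by
  rcases Nat.lt_or_ge n 3 with h3 | h3
  · have h2 := two_le_of_mem_firstFailures hx
    obtain rfl : n = 2 := by omega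
    exact stub_branchFiniteness_rankTwo x ⟨hx.1, by exact_mod_cast hx.2.1⟩
  · exact branch_finite_higherRank h3 hx

/-- THE LOG SECTOR NEEDS NO RESIDUE (sorry-free): if every `e^{x_i}` is algebraic, the exponentials of the mates of `x`
are coordinatewise roots of the minimal polynomials of the `e^{x_i}` — finitely many (no first-failure hypothesis;
ported from the sibling skeleton sweep-below-rank). -/
theorem expImage_finite_of_algebraic {x : Fin n → ℂ} (halg : ∀ i, IsAlgebraic ℚ (cexp (x i))) :
    ((fun x' : Fin n → ℂ => cexp ∘ x') '' locusMates x).Finite := by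
  classical
  have key : ∀ x' ∈ locusMates x, ∀ i, cexp (x' i) ∈ (minpoly ℚ (cexp (x i))).rootSet ℂ := by
    intro x' hx' i
    have hne : minpoly ℚ (cexp (x i)) ≠ 0 := minpoly.ne_zero (halg i).isIntegral
    rw [Polynomial.mem_rootSet_of_ne hne]
    have h := hx'.2
      (Polynomial.aeval (MvPolynomial.X (Sum.inr i) : MvPolynomial (Fin n ⊕ Fin n) ℚ) (minpoly ℚ (cexp (x i)))) (by
        rw [← Polynomial.aeval_algHom_apply, MvPolynomial.aeval_X]
        simp [minpoly.aeval])
    rw [← Polynomial.aeval_algHom_apply, MvPolynomial.aeval_X] at h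
    simpa using h
  refine (Set.Finite.pi' fun i : Fin n => Polynomial.rootSet_finite (minpoly ℚ (cexp (x i))) ℂ).subset ?_
  rintro _ ⟨x', hx', rfl⟩
  exact fun i => key x' hx' i

/-- Exp-image finiteness in every sector: the log sector by `expImage_finite_of_algebraic`, off it by stub 5'. -/
theorem expImage_finite_voc {x : Fin n → ℂ} (hx : x ∈ firstFailures n) :
    ((fun x' : Fin n → ℂ => cexp ∘ x') '' locusMates x).Finite := by
  by_cases halg : ∀ j, IsAlgebraic ℚ (cexp (x j))
  · exact expImage_finite_of_algebraic halg
  · obtain ⟨j, hj⟩ := not_forall.mp halg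
    exact stub_expImageFinite_offLog n x hx ⟨j, hj⟩

/-! ## Sorry-free glue (closed lemmas; hypotheses are concrete, never the stubs) -/

/-- Every ℚ-linearly independent tuple is its own mate. -/
theorem self_mem_locusMates (x : Fin n → ℂ) (hx : LinearIndependent ℚ x) : x ∈ locusMates x :=
  ⟨hx, fun _ hp => hp⟩

/-- Two tuples with the same exponentials differ by a kernel translate. -/
theorem exists_kerTranslate_of_cexp_eq {x₀ x' : Fin n → ℂ} (h : cexp ∘ x' = cexp ∘ x₀) :
    ∃ k : Fin n → ℤ, x' = kerTranslate x₀ k := by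
  have hk : ∀ i, ∃ m : ℤ, x' i = x₀ i + m * (2 * ↑Real.pi * I) := fun i =>
    Complex.exp_eq_exp_iff_exists_int.1 (congr_fun h i)
  choose k hk using hk
  refine ⟨k, funext fun i => ?_⟩
  rw [hk i, kerTranslate]
  ring

/-- FINITENESS OF THE MATE SET from the two parameters: finitely many kernel classes (`hExp`), each met finitely
(`hBr` at a representative `x₀` of the class, transported along the mate equivalence `hMate`). -/
theorem locusMates_finite
    (hMate : ∀ x₀ x' : Fin n → ℂ, x₀ ∈ firstFailures n → x' ∈ locusMates x₀ →
      x' ∈ firstFailures n ∧ locusPts x' = locusPts x₀)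
    (hBr : ∀ x₀ : Fin n → ℂ, x₀ ∈ firstFailures n → {k : Fin n → ℤ | kerTranslate x₀ k ∈ locusMates x₀}.Finite)
    {x : Fin n → ℂ} (hx : x ∈ firstFailures n)
    (hExp : ((fun x' : Fin n → ℂ => cexp ∘ x') '' locusMates x).Finite) :
    (locusMates x).Finite := by
  refine Set.Finite.subset (hExp.biUnion
    (t := fun y => locusMates x ∩ (fun x' : Fin n → ℂ => cexp ∘ x') ⁻¹' {y}) ?_) ?_
  · rintro y ⟨x₀, hx₀M, rfl⟩
    obtain ⟨hff₀, hlocus₀⟩ := hMate x x₀ hx hx₀M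
    have hMeq : locusMates x₀ = locusMates x := by
      unfold locusMates
      rw [hlocus₀]
    refine ((hBr x₀ hff₀).image (kerTranslate x₀)).subset ?_
    rintro x' ⟨hx'M, hx'E⟩
    have hE : cexp ∘ x' = cexp ∘ x₀ := by
      simpa only [mem_preimage, mem_singleton_iff] using hx'E
    obtain ⟨k, rfl⟩ := exists_kerTranslate_of_cexp_eq hE
    refine ⟨k, ?_, rfl⟩
    show kerTranslate x₀ k ∈ locusMates x₀
    rw [hMeq]
    exact hx'M
  · intro x' hx'
    exact Set.mem_iUnion₂.2 ⟨cexp ∘ x', ⟨x', hx', rfl⟩, hx', rfl⟩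

/-- DEFINABILITY OF THE MATE SET ("definable isolation is free"): intersection of the two definable pieces. -/
theorem locusMates_definable {x : Fin n → ℂ}
    (hLI : (∅ : Set ℂ).Definable Language.expRing {v : Fin n → ℂ | LinearIndependent ℚ v})
    (hLoc : (∅ : Set ℂ).Definable Language.expRing (locusPts x)) :
    (∅ : Set ℂ).Definable Language.expRing (locusMates x) :=
  hLI.inter hLoc

/-- Coordinates of a finite `∅`-definable set of tuples lie in finite `∅`-definable subsets of `ℂ`
(projection `Set.Definable.image_comp` along `Fin 1 → Fin n`). -/
theorem coord_mem_expAcl {M : Set (Fin n → ℂ)} (hfin : M.Finite)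
    (hdef : (∅ : Set ℂ).Definable Language.expRing M) {x : Fin n → ℂ} (hx : x ∈ M) (i : Fin n) :
    ∃ s : Set ℂ, s.Finite ∧ Set.Definable₁ (∅ : Set ℂ) Language.expRing s ∧ x i ∈ s := by
  refine ⟨(fun x' : Fin n → ℂ => x' i) '' M, hfin.image _, ?_, ⟨x, hx, rfl⟩⟩
  have himg := hdef.image_comp (fun _ : Fin 1 => i)
  unfold Set.Definable₁
  convert himg using 1
  ext v
  simp only [mem_setOf_eq, mem_image]
  constructor
  · rintro ⟨x', hx', hv⟩
    refine ⟨x', hx', funext fun j => ?_⟩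
    have hj : j = 0 := Subsingleton.elim j 0
    subst hj
    simpa using hv
  · rintro ⟨x', hx', rfl⟩
    exact ⟨x', hx', rfl⟩

/-- The sorry-free core of the line: SPARSITY (finite mate set) + DEFINABILITY (of its two pieces) give acl-membership of
every coordinate of a first failure. (Not stated with the crux's name: `MinimalCounterexampleInAcl_of` below is the only
theorem concluding the crux.) -/
theorem coord_mem_expAcl_of_sparsity {x : Fin n → ℂ} (hx : x ∈ firstFailures n) (hfin : (locusMates x).Finite)
    (hLI : (∅ : Set ℂ).Definable Language.expRing {v : Fin n → ℂ | LinearIndependent ℚ v})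
    (hLoc : (∅ : Set ℂ).Definable Language.expRing (locusPts x)) (i : Fin n) :
    ∃ s : Set ℂ, s.Finite ∧ Set.Definable₁ (∅ : Set ℂ) Language.expRing s ∧ x i ∈ s :=
  coord_mem_expAcl hfin (locusMates_definable hLI hLoc) (self_mem_locusMates x hx.1) i

/-! ## Rank bookkeeping (sorry-free): the first open case is `n = 2`, where the inductive hypothesis is a theorem -/

/-- Schanuel holds in ranks `0` and `1` (tree: `schanuelRank_zero`; `schanuelRank_one` above, Hermite–Lindemann), so at
rank `2` a first failure is just a ℚ-linearly independent pair with `trdeg ℚ(x, eˣ) < 2` — `CruxRankTwo` of the Disproof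
(§11; there `trdeg = 1` exactly) in this vocabulary, which is why `stub_branchFiniteness_rankTwo` carries no inductive
hypothesis. Recorded as sorry-free `example`s (documentation for the lead's rank-2 milestone; no named declaration off
the path to the crux). -/
example : ∀ r < 2, SchanuelRank r := by
  intro r hr
  interval_cases r
  · exact Literature.NumberTheory.Transcendental.schanuelRank_zero
  · exact schanuelRank_one

example {x : Fin 2 → ℂ} : x ∈ firstFailures 2 ↔
    LinearIndependent ℚ x ∧
    Algebra.trdeg ℚ ↥(IntermediateField.adjoin ℚ (range x ∪ range (cexp ∘ x))) < (2 : Cardinal) := by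
  have hSR : ∀ r < 2, SchanuelRank r := by
    intro r hr
    interval_cases r
    · exact Literature.NumberTheory.Transcendental.schanuelRank_zero
    · exact schanuelRank_one
  show (LinearIndependent ℚ x ∧ _ ∧ ∀ r < 2, SchanuelRank r) ↔ _
  exact ⟨fun h => ⟨h.1, by exact_mod_cast h.2.1⟩, fun h => ⟨h.1, by exact_mod_cast h.2, hSR⟩⟩

/-- There is no first failure at rank `0` (the bound `trdeg < 0` is unsatisfiable), so the crux is vacuous there. -/
example (x : Fin 0 → ℂ) : x ∉ firstFailures 0 := by
  rintro ⟨-, htr, -⟩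
  simp at htr

/-! ## The composition: the ONLY theorem of this file concluding the crux, BY NAME -/

/-- **(S*) from the seven stubs.** For a first failure `x`, `locusMates x` is FINITE (finitely many classes: log sector in
glue, `stub_expImageFinite_offLog` off it; each class finite: `stub_branchFiniteness_rankTwo` in rank 2,
`stub_sweepToSubspace_higherRank` + `stub_endgame` in ranks ≥ 3, at each class representative, transported by
`stub_mateFirstFailure`) and `∅`-DEFINABLE
(`stub_linearIndependentDefinable ∩ stub_locusDefinable`), and contains `x`; project to the `i`-th coordinate. -/
theorem MinimalCounterexampleInAcl_of :
    Summit.Schanuel.Schanuel.Theses.RigidCore.MinimalCounterexampleInAcl := by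
  intro n x hx htr hSR i
  have hff : x ∈ firstFailures n := ⟨hx, htr, hSR⟩
  have hfin : (locusMates x).Finite :=
    locusMates_finite (fun x₀ x' h₀ h' => mate_firstFailure_voc h₀ h') (fun x₀ h₀ => branch_finite_voc h₀) hff
      (expImage_finite_voc hff)
  exact coord_mem_expAcl_of_sparsity hff hfin (linearIndependent_definable_voc n) (locusPts_definable_voc x) i

/-- Sanity (vocabulary check, sorry-free): the crux's conclusion is literally membership in the tree's `expAcl`
(`Theorems.AclSubsetLogFreeCore.Negative.LogFreeCoreObjects`), the hypothesis of the sibling crux (A). -/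
example (h : Summit.Schanuel.Schanuel.Theses.RigidCore.MinimalCounterexampleInAcl) (x : Fin n → ℂ)
    (hx : x ∈ firstFailures n) (i : Fin n) : x i ∈ expAcl :=
  h n x hx.1 hx.2.1 hx.2.2 i

end Summit.Schanuel.Schanuel.Cruxes.MinimalCounterexampleInAcl.KernelArithmeticSelection

end
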